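/-
Copyright: b2b-lace packet (LEAN TYPING SEAT 1 gen 35, node BESSELJ-ORDERTAIL-LIT, a leaf under
BESSELJ-ORDERTAIL-GEOM / BESSELJ-LITCERT). The Bessel-J ORDER TAIL `δ_J(y) = Σ_{l≥0}|J_{l+J+1}(y)|` — the
`δ̄` input of every twisted-seed truncation budget — as ONE rational literal decided from the SAME
`JLit.Cert` that supplies the coefficient literals: finitely many tail orders from the certificate, the
rest by the geometric closed form. d-free; number-free; def-free; what-if / input-certification lane
SUPPORT; nothing here is a certificate; no statement at any fixed dimension.
-/
import Literature.Probability.FitznerVanDerHofstad2017.SrwTwistRowOrderBall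
import Literature.Analysis.FunctionSpaces.BesselJOrderTailGeometric
import Literature.Analysis.FunctionSpaces.BesselJLiteralCert
import HarnessLib

/-!
# The Bessel-`J` order tail as a literal from a coefficient certificate

CITATION HEADER (PLACEMENT v2). Part of the certified REPRODUCTION of the numerical inputs of
R. Fitzner, R. van der Hofstad, *Generalized approach to the non-backtracking lace expansion*,
Probab. Theory Related Fields 169 (2017) 1041–1119 [NoBLE17-I] (arXiv:1506.07969), §5.1.1 (5.2)–(5.5)
pp. 1089–1090 (the Bessel rows of the notebook `SRW.nb`); the Bessel facts are NIST DLMF §10.2.2 (power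
series) and §10.14.4 (`|J_n(x)| ≤ |x/2|^n/n!`) [DLMF].  Nothing in this file is a claim of the paper;
everything below is PROVED.

## What this module adds

Every truncation budget of the twisted-seed chain (`SrwTwistTruncationBudget`, `…Seeds`, `…KeptSliceBudget`,
`…ProductSliceBudget`, the certificate kernels `SrwTwistSeedCertRowBound`, …) takes the ORDER TAIL
`δ_J(y) = Σ_{l≥0}|J_{l+J+1}(y)|` (`y = β/d`) through a scalar hypothesis `δ_J(y) ≤ δ̄`.  In the tree `δ̄` is
available in closed form for `|y| ≤ 1` (`tsum_abs_besselJ_tail_le_of_abs_le_one`) and, for `y² ≤ 4(J+2)`,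
by the geometric bound of `BesselJOrderTailGeometric` (`tsum_abs_besselJ_orderTail_le_geom`,
`…_le_sum_add_geom`).  Two gaps for a literal consumer: the side condition `y² ≤ 4(J+2)` fails at `J = 0`,
`y = 3` (the m-uniform device at `β = 3d`), and the sharp form `…_le_sum_add_geom` still contains the real
numbers `|J_{l+J+1}(y)|`, `l < K`.  Here:

* `tsum_abs_besselJ_orderTail_le_sum_add_geom_of_sq_le (J K) (h : y² ≤ 4((J+K)+2))` — the finite-plus-
  geometric split for EVERY real `y` (summability of the order tail holds for all `y`,
  `summable_abs_besselJ_tail`; the geometric closed form is only needed at order `J+K`);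
* `tsum_abs_besselJ_orderTail_le_lit` — with a literal table `|q_{l+J+1} − J_{l+J+1}(y)| ≤ e`, `l < K`:
  `δ_J(y) ≤ Σ_{l<K}(|q_{l+J+1}| + e) + |y/2|^{J+K+1}/(J+K+1)! · ((J+K)+2)/(((J+K)+2) − |y/2|)`;
* `tsum_abs_besselJ_orderTail_le_lit_cast` — `y, e ∈ ℚ`, `q : ℕ → ℚ`, the side condition
  `y² ≤ 4((J+K)+2)` stated in `ℚ` (decidable), the right-hand side ONE rational expression cast to `ℝ`;
* `tsum_abs_besselJ_orderTail_le_of_jlit (c : JLit.Cert) (hc : c.check = true) (hL : J+K+1 ≤ c.L)` and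
  its `_of_eq` form (real argument `x` with `((c.y : ℚ) : ℝ) = x`, e.g. `x = β/d`) — the order tail at the
  certificate's argument bounded by a rational literal in the certificate's OWN entries `c.q`, `c.eps`:
  a K1 / K2 / kept-slice / m-uniform instance decides its `δ̄` from the certificate it already carries
  (accuracy `K·eps` plus the geometric remainder at order `J+K+1`).

Everything is PROVED (standard axioms), free of the dimension, number-free and def-free; no instance, no
table, no named fact.  Epistemic status / lane: what-if / input-certification SUPPORT; nothing here is a
certificate; no statement at a specific dimension.

## References
* R. Fitzner, R. van der Hofstad, *Generalized approach to the non-backtracking lace expansion*,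
  PTRF 169 (2017) 1041–1119 (arXiv:1506.07969), §5.1.1 (5.2)–(5.5) pp. 1089–1090.
  [FitznerVanDerHofstad2016NoBLE]
* NIST DLMF §10.2.2, §10.14.4. [DLMF]
[cite: DLMF, 10.2.2, 10.14.4; FitznerVanDerHofstad2016NoBLE, §5.1.1 (5.2)–(5.5) pp. 1089–1090]
-/

noncomputable section

open scoped Nat

namespace Literature.Probability.FitznerVanDerHofstad2017

open Literature.Analysis.FunctionSpaces (besselJ JLit.Cert)

/-- **Finite-plus-geometric split of the order tail, every `y`.** For `y² ≤ 4((J+K)+2)`: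
`Σ_{l≥0}|J_{l+J+1}(y)| ≤ Σ_{l<K}|J_{l+J+1}(y)| + |y/2|^{J+K+1}/(J+K+1)! · ((J+K)+2)/(((J+K)+2) − |y/2|)`.
[cite: DLMF, 10.2.2, 10.14.4] -/
theorem tsum_abs_besselJ_orderTail_le_sum_add_geom_of_sq_le (J K : ℕ) {y : ℝ}
    (h : y ^ 2 ≤ 4 * (((J + K : ℕ) : ℝ) + 2)) :
    ∑' l : ℕ, |besselJ (l + J + 1) y|
      ≤ ∑ l ∈ Finset.range K, |besselJ (l + J + 1) y|
        + |y / 2| ^ (J + K + 1) / ((J + K + 1)! : ℝ)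
          * ((((J + K : ℕ) : ℝ) + 2) / ((((J + K : ℕ) : ℝ) + 2) - |y / 2|)) := by
  rw [Literature.Analysis.FunctionSpaces.tsum_abs_besselJ_orderTail_eq_sum_add_tsum J K
    (summable_abs_besselJ_tail J y)]
  exact add_le_add le_rfl (Literature.Analysis.FunctionSpaces.tsum_abs_besselJ_orderTail_le_geom (J + K) h)

/-- **Order tail from a literal table.** For `y² ≤ 4((J+K)+2)` and `|q_{l+J+1} − J_{l+J+1}(y)| ≤ e`
(`l < K`): `Σ_{l≥0}|J_{l+J+1}(y)| ≤ Σ_{l<K}(|q_{l+J+1}| + e) + |y/2|^{J+K+1}/(J+K+1)! · ((J+K)+2)/(((J+K)+2) − |y/2|)`.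
[cite: DLMF, 10.2.2, 10.14.4] -/
theorem tsum_abs_besselJ_orderTail_le_lit (J K : ℕ) {y e : ℝ} (q : ℕ → ℝ)
    (h : y ^ 2 ≤ 4 * (((J + K : ℕ) : ℝ) + 2))
    (hq : ∀ l ∈ Finset.range K, |q (l + J + 1) - besselJ (l + J + 1) y| ≤ e) :
    ∑' l : ℕ, |besselJ (l + J + 1) y|
      ≤ ∑ l ∈ Finset.range K, (|q (l + J + 1)| + e)
        + |y / 2| ^ (J + K + 1) / ((J + K + 1)! : ℝ)
          * ((((J + K : ℕ) : ℝ) + 2) / ((((J + K : ℕ) : ℝ) + 2) - |y / 2|)) := by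
  refine (tsum_abs_besselJ_orderTail_le_sum_add_geom_of_sq_le J K h).trans
    (add_le_add (Finset.sum_le_sum fun l hl => ?_) le_rfl)
  have h1 := hq l hl
  have h2 := abs_sub_abs_le_abs_sub (besselJ (l + J + 1) y) (q (l + J + 1))
  rw [abs_sub_comm] at h2
  linarith

/-- **Order tail from a rational literal table.** For `y, e ∈ ℚ`, `q : ℕ → ℚ` with `y² ≤ 4((J+K)+2)`
(decidable) and `|q_{l+J+1} − J_{l+J+1}(y)| ≤ e` (`l < K`):
`Σ_{l≥0}|J_{l+J+1}(y)| ≤ ((Σ_{l<K}(|q_{l+J+1}| + e) + |y/2|^{J+K+1}/(J+K+1)! · ((J+K)+2)/(((J+K)+2) − |y/2|) : ℚ) : ℝ)`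
— ONE rational expression cast to `ℝ`. [cite: DLMF, 10.2.2, 10.14.4] -/
theorem tsum_abs_besselJ_orderTail_le_lit_cast (J K : ℕ) (y e : ℚ) (q : ℕ → ℚ)
    (h : y ^ 2 ≤ 4 * (((J + K : ℕ) : ℚ) + 2))
    (hq : ∀ l ∈ Finset.range K, |((q (l + J + 1) : ℚ) : ℝ) - besselJ (l + J + 1) (y : ℝ)| ≤ (e : ℝ)) :
    ∑' l : ℕ, |besselJ (l + J + 1) (y : ℝ)|
      ≤ ((∑ l ∈ Finset.range K, (|q (l + J + 1)| + e)
          + |y / 2| ^ (J + K + 1) / ((J + K + 1)! : ℚ)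
            * ((((J + K : ℕ) : ℚ) + 2) / ((((J + K : ℕ) : ℚ) + 2) - |y / 2|)) : ℚ) : ℝ) := by
  have h' : ((y : ℚ) : ℝ) ^ 2 ≤ 4 * (((J + K : ℕ) : ℝ) + 2) := by exact_mod_cast h
  have hmain := tsum_abs_besselJ_orderTail_le_lit J K (fun j => ((q j : ℚ) : ℝ)) h' hq
  have hR : ((∑ l ∈ Finset.range K, (|q (l + J + 1)| + e)
          + |y / 2| ^ (J + K + 1) / ((J + K + 1)! : ℚ)
            * ((((J + K : ℕ) : ℚ) + 2) / ((((J + K : ℕ) : ℚ) + 2) - |y / 2|)) : ℚ) : ℝ)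
      = ∑ l ∈ Finset.range K, (|((q (l + J + 1) : ℚ) : ℝ)| + (e : ℝ))
        + |(y : ℝ) / 2| ^ (J + K + 1) / ((J + K + 1)! : ℝ)
          * ((((J + K : ℕ) : ℝ) + 2) / ((((J + K : ℕ) : ℝ) + 2) - |(y : ℝ) / 2|)) := by
    push_cast
    ring
  rw [hR]
  exact hmain

/-- **Order tail from a coefficient certificate.** For a decided `JLit.Cert` `c` (`c.check = true`) with
`J + K + 1 ≤ c.L` and `c.y² ≤ 4((J+K)+2)`:
`Σ_{l≥0}|J_{l+J+1}(c.y)| ≤ ((Σ_{l<K}(|c.q(l+J+1)| + c.eps) + |c.y/2|^{J+K+1}/(J+K+1)! · ((J+K)+2)/(((J+K)+2) − |c.y/2|) : ℚ) : ℝ)`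
— the `δ̄` of a truncation budget as a rational literal in the certificate's own entries.
[cite: DLMF, 10.2.2, 10.14.4; FitznerVanDerHofstad2016NoBLE, §5.1.1 (5.2)–(5.5) pp. 1089–1090] -/
theorem tsum_abs_besselJ_orderTail_le_of_jlit (c : JLit.Cert) (hc : c.check = true) (J K : ℕ)
    (hL : J + K + 1 ≤ c.L) (h : c.y ^ 2 ≤ 4 * (((J + K : ℕ) : ℚ) + 2)) :
    ∑' l : ℕ, |besselJ (l + J + 1) (c.y : ℝ)|
      ≤ ((∑ l ∈ Finset.range K, (|c.q (l + J + 1)| + c.eps)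
          + |c.y / 2| ^ (J + K + 1) / ((J + K + 1)! : ℚ)
            * ((((J + K : ℕ) : ℚ) + 2) / ((((J + K : ℕ) : ℚ) + 2) - |c.y / 2|)) : ℚ) : ℝ) :=
  tsum_abs_besselJ_orderTail_le_lit_cast J K c.y c.eps c.q h fun l hl => by
    have hl : l + J + 1 < c.L := by have := Finset.mem_range.1 hl; omega
    exact c.abs_sub_le_of_entryOK (c.entryOK_of_check hc hl)

/-- `tsum_abs_besselJ_orderTail_le_of_jlit` at a real argument `x` provably equal to the certificate's
rational `c.y` (e.g. `x = β/d`). [cite: DLMF, 10.2.2, 10.14.4; FitznerVanDerHofstad2016NoBLE, §5.1.1 (5.2)–(5.5) pp. 1089–1090] -/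
theorem tsum_abs_besselJ_orderTail_le_of_jlit_of_eq (c : JLit.Cert) (hc : c.check = true) {x : ℝ}
    (hx : ((c.y : ℚ) : ℝ) = x) (J K : ℕ) (hL : J + K + 1 ≤ c.L)
    (h : c.y ^ 2 ≤ 4 * (((J + K : ℕ) : ℚ) + 2)) :
    ∑' l : ℕ, |besselJ (l + J + 1) x|
      ≤ ((∑ l ∈ Finset.range K, (|c.q (l + J + 1)| + c.eps)
          + |c.y / 2| ^ (J + K + 1) / ((J + K + 1)! : ℚ)
            * ((((J + K : ℕ) : ℚ) + 2) / ((((J + K : ℕ) : ℚ) + 2) - |c.y / 2|)) : ℚ) : ℝ) :=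
  hx ▸ tsum_abs_besselJ_orderTail_le_of_jlit c hc J K hL h

/-! ### Smoke test: the side conditions are kernel-decidable on a concrete certificate

On the landed four-entry instance `JLit.smoke` (`y = 1/2`, `L = 4`, `eps = 10⁻⁶`): `δ_0(1/2)` from three
certificate orders plus the geometric remainder at order 4 — `hL` and the `ℚ` side condition by `decide`. -/

example : ∑' l : ℕ, |besselJ (l + 0 + 1) ((Literature.Analysis.FunctionSpaces.JLit.smoke.y : ℚ) : ℝ)|
    ≤ ((∑ l ∈ Finset.range 3, (|Literature.Analysis.FunctionSpaces.JLit.smoke.q (l + 0 + 1)|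
          + Literature.Analysis.FunctionSpaces.JLit.smoke.eps)
        + |Literature.Analysis.FunctionSpaces.JLit.smoke.y / 2| ^ (0 + 3 + 1) / ((0 + 3 + 1)! : ℚ)
          * ((((0 + 3 : ℕ) : ℚ) + 2) / ((((0 + 3 : ℕ) : ℚ) + 2)
            - |Literature.Analysis.FunctionSpaces.JLit.smoke.y / 2|)) : ℚ) : ℝ) :=
  tsum_abs_besselJ_orderTail_le_of_jlit _ Literature.Analysis.FunctionSpaces.JLit.smoke_check 0 3
    (by decide) (by decide +kernel)

end Literature.Probability.FitznerVanDerHofstad2017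

end
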